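import Summits.ResolutionOfSingularities.ResolutionOfSingularities.Theorems.EquisingularLiftEquisingularLiftNatDirectionCoordinates
import HarnessLib

/-!
# [OURS · L1 W4.5b · T-DIRLIFT-UP route C, brick B1 of C1c] Quasi-regularity of a generating PAIR is a property of the ideal (local ring)

Cell res-hironaka, LADDER-RESOLUTION rung L, slot W4.5(b), crux chain w45b (EL♮(3) = stmt-ResolutionOfSingularities-20148); object
T-DIRLIFT-UP (res-L1-w45b-plan-1 RULING 19:14:55Z, route C), brick C1c (`L/res-D-pv-051/TARGET-C1c.sig.lean` b928b225abc4a457), sub-brick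
B1. `--supports stmt-ResolutionOfSingularities-20148 --as helper`. THEOREMS ONLY; def-free; NOT a statement of any manuscript; AI-written,
AI review weaker than expert review.

WHAT. In a LOCAL ring `A`, if `c' = (ℓ′, m′)` is a quasi-regular pair generating `I ⊆ 𝔪` and `c = (ℓ, m)` generates the same ideal, then
`c` is quasi-regular (`isQuasiRegular_of_span_eq`): the two change-of-generators matrices `M`, `N` (`c = M c'`, `c' = N c`) satisfy
`N M ≡ 1 (mod I)` by quasi-regularity in degree one (`mem_of_linearComb_mem_sq`, p561783), so `det M` is a unit of the local ring and the
substitution is invertible (`IsQuasiRegular.of_linearSubst`, p555912). WHY: route C reads the downstairs direction `𝒟'` in the CHART frame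
`(j₀♯x₀, j₀♯x₁)` of the trace ideal `Ī`, whose quasi-regularity at a point is only known for SOME frame (`hdir'`); this lemma transfers it.
References (method): Matsumura, CRT §16 (quasi-regular sequences); Stacks Tag 063H (change of generators mod `I`).
-/

set_option linter.dupNamespace false -- mandated namespace `Summit.<Summit>.<Problem>` of this single-conjunct summit

namespace Summit.ResolutionOfSingularities.ResolutionOfSingularities.Cruxes.EquisingularLiftNat.Sections

open IsLocalRing Literature.AlgebraicGeometry.Resolution

universe u

variable {A : Type u} [CommRing A]

/-- In a local ring, `a * b - 1 ∈ 𝔪` forces `b` to be a unit. [folklore] -/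
theorem isUnit_of_mul_sub_one_mem_maximalIdeal [IsLocalRing A] {a b : A} (h : a * b - 1 ∈ maximalIdeal A) : IsUnit b := by
  by_contra hb
  have hb' : b ∈ maximalIdeal A := (mem_maximalIdeal b).mpr (mem_nonunits_iff.mpr hb)
  have h1 : (1 : A) ∈ maximalIdeal A := by
    have := Ideal.sub_mem _ (Ideal.mul_mem_left _ a hb') h
    rwa [sub_sub_cancel] at this
  exact (maximalIdeal.isMaximal A).ne_top (Ideal.eq_top_of_isUnit_mem _ h1 isUnit_one)

/-- **The change-of-generators determinant is a unit.** If `c' = (ℓ′, m′)` is quasi-regular, generates `I ⊆ 𝔪` (local ring), and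
`c = (ℓ, m)` with `ℓ = αℓ′ + βm′`, `m = γℓ′ + δm′` generates `I` too, then `αδ − βγ` is a unit. [cite: StacksProject, Tag 063H] -/
theorem isUnit_det_of_span_pair_eq [IsLocalRing A] {c c' : Fin 2 → A} (hc' : IsQuasiRegular c')
    (h𝔪 : Ideal.span (Set.range c') ≤ maximalIdeal A) (h : Ideal.span (Set.range c) = Ideal.span (Set.range c'))
    {α β γ δ : A} (h0 : c 0 = α * c' 0 + β * c' 1) (h1 : c 1 = γ * c' 0 + δ * c' 1) : IsUnit (α * δ - β * γ) := by
  -- coordinates of `c'` in `c`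
  obtain ⟨p, q, hp⟩ := exists_coords_of_mem c
    (show c' 0 ∈ Ideal.span (Set.range c) from h ▸ Ideal.subset_span (Set.mem_range_self 0))
  obtain ⟨r, s, hr⟩ := exists_coords_of_mem c
    (show c' 1 ∈ Ideal.span (Set.range c) from h ▸ Ideal.subset_span (Set.mem_range_self 1))
  -- `N M ≡ 1 (mod I)` from the trivial relations among `ℓ′, m′`
  have hℓ : (p * α + q * γ - 1) * c' 0 + (p * β + q * δ) * c' 1 ∈ Ideal.span (Set.range c') ^ 2 := by
    have e : (p * α + q * γ - 1) * c' 0 + (p * β + q * δ) * c' 1 = 0 := by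
      have := hp; rw [h0, h1] at this; linear_combination -this
    rw [e]; exact zero_mem _
  have hm : (r * α + s * γ) * c' 0 + (r * β + s * δ - 1) * c' 1 ∈ Ideal.span (Set.range c') ^ 2 := by
    have e : (r * α + s * γ) * c' 0 + (r * β + s * δ - 1) * c' 1 = 0 := by
      have := hr; rw [h0, h1] at this; linear_combination -this
    rw [e]; exact zero_mem _
  obtain ⟨h11, h12⟩ := mem_of_linearComb_mem_sq hc' hℓ
  obtain ⟨h21, h22⟩ := mem_of_linearComb_mem_sq hc' hm
  -- `det N · det M − 1 ∈ I ⊆ 𝔪`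
  have hdet : (p * s - q * r) * (α * δ - β * γ) - 1 ∈ Ideal.span (Set.range c') := by
    have e : (p * s - q * r) * (α * δ - β * γ) - 1 =
        (p * α + q * γ - 1) * (r * β + s * δ - 1) + (p * α + q * γ - 1) + (r * β + s * δ - 1) - (p * β + q * δ) * (r * α + s * γ) := by
      ring
    rw [e]
    exact Ideal.sub_mem _ (Ideal.add_mem _ (Ideal.add_mem _ (Ideal.mul_mem_left _ _ h22) h11) h22) (Ideal.mul_mem_right _ _ h12)
  exact isUnit_of_mul_sub_one_mem_maximalIdeal (h𝔪 hdet)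

open MvPolynomial in
/-- **Quasi-regularity of a generating pair is a property of the ideal (local ring).** If `c'` is a quasi-regular pair generating
`I ⊆ 𝔪` and the pair `c` generates the same ideal, then `c` is quasi-regular: `c = M c'` with `det M` a unit
(`isUnit_det_of_span_pair_eq`), so `c' ↦ c` is an invertible linear substitution (`IsQuasiRegular.of_linearSubst`).
[cite: Matsumura1987, §16 Definition p. 124] [cite: StacksProject, Tag 063H] -/
theorem isQuasiRegular_of_span_eq [IsLocalRing A] {c c' : Fin 2 → A} (hc' : IsQuasiRegular c')
    (h𝔪 : Ideal.span (Set.range c') ≤ maximalIdeal A) (h : Ideal.span (Set.range c) = Ideal.span (Set.range c')) :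
    IsQuasiRegular c := by
  obtain ⟨α, β, h0⟩ := exists_coords_of_mem c'
    (show c 0 ∈ Ideal.span (Set.range c') from h.symm ▸ Ideal.subset_span (Set.mem_range_self 0))
  obtain ⟨γ, δ, h1⟩ := exists_coords_of_mem c'
    (show c 1 ∈ Ideal.span (Set.range c') from h.symm ▸ Ideal.subset_span (Set.mem_range_self 1))
  obtain ⟨w, hw⟩ := (isUnit_det_of_span_pair_eq hc' h𝔪 h h0 h1).exists_left_inv
  -- `f = M X`, `g = M⁻¹ X`
  refine IsQuasiRegular.of_linearSubst (x := c') (y := c)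
    ![C α * X 0 + C β * X 1, C γ * X 0 + C δ * X 1]
    ![C (w * δ) * X 0 - C (w * β) * X 1, C (w * α) * X 1 - C (w * γ) * X 0] ?_ ?_ ?_ h hc'
  · intro i
    fin_cases i
    · simpa using ((isHomogeneous_X A (0 : Fin 2)).C_mul α).add ((isHomogeneous_X A (1 : Fin 2)).C_mul β)
    · simpa using ((isHomogeneous_X A (0 : Fin 2)).C_mul γ).add ((isHomogeneous_X A (1 : Fin 2)).C_mul δ)
  · have hw' : C w * (C α * C δ - C β * C γ) = (1 : MvPolynomial (Fin 2) A) := by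
      rw [← map_mul, ← map_mul, ← map_sub, ← map_mul, hw, C_1]
    intro i
    fin_cases i
    · simp only [Fin.zero_eta, Matrix.cons_val_zero, Matrix.cons_val_one, Matrix.cons_val_fin_one, map_add, map_mul,
        bind₁_C_right, bind₁_X_right]
      linear_combination (X 0 : MvPolynomial (Fin 2) A) * hw'
    · simp only [Fin.mk_one, Matrix.cons_val_one, Matrix.cons_val_zero, Matrix.cons_val_fin_one, map_add, map_mul,
        bind₁_C_right, bind₁_X_right]
      linear_combination (X 1 : MvPolynomial (Fin 2) A) * hw'
  · intro i
    fin_cases i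
    · simp [h0]
    · simp [h1]

end Summit.ResolutionOfSingularities.ResolutionOfSingularities.Cruxes.EquisingularLiftNat.Sections
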